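import Literature.Computability.Complexity.BranchingProgramEntropy
import Summits.PneNP.PneNP.Theorems.SzkEntropyPeaThreeNotInPSocketPED
import Summits.PneNP.PneNP.Theorems.SzkEntropyPeaThreeNotInPStubTransfer
import HarnessLib

/-!
# Route SzkEntropy, crux `PeaThreeNotInP` (stmt-PneNP-10776), line `SketchIdeator3`, socket rider:
# the WEAK-GAP entropy-difference socket `PEDBPGap num den → PED 3`
# (stubs `stub_toPEDGap_mem`, `stub_toPEDGapRawFP`)

Clients of the socket rider (e.g. the cube-smoothed lattice sampler) certify only a CONSTANT
entropy-difference gap `ρ = num/den` between two branching-program samplers `p = (n, Bs)`,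
`q = (n', Bs')`: far ⇒ `H(q) ≤ H(p)`, close ⇒ `H(p) + ρ ≤ H(q)` — the promise problem
`PEDBPGap num den`.  Dvir–Gutfreund–Rothblum–Vadhan amplify such a gap at the level of the
polynomial maps (§3 p. 6: `H(Pᵗ) = t · H(P)` for the `t`-fold direct product): with
`T = 2 · den` copies of each side's degree-3 perfect randomized encoding (`encodeBDDsMap`,
entropy `H + m`, `entropy_encodeBDDsMap`; iterated products `powMap`, `entropy_powMap`), the
identity-map padding of the sibling socket `toPED` scaled by `T` (so that both sides are shifted
by the same `T · (m + m')`), and ONE extra free bit on the first side,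

  `H(p') − H(q') = T · (H(p) − H(q)) + 1`,

so far ⇒ `H(q') + 1 ≤ H(p')` (YES of `PED 3`) and close ⇒ `H(q') − H(p') ≥ 2 num − 1 ≥ 1`
(NO of `PED 3`): `stub_toPEDGap_mem`.  All maps have degree `≤ 3` (`degLE_powMap`,
`degLE_idMap`).  The raw form `toPEDGapRaw` (nested lists of naturals; `powN` = raw `powMap`,
`prodRaw`, `idMapRaw`) is typed polynomial time on codes given a `CodeFP` program for
`encodeBDDsRaw` (`stub_toPEDGapRawFP`): as `stub_toPEDRawFP`, plus `codeFP_powN` with the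
constant copy list `[0, T)`, the identity maps budgeted in unary by the `T` copies of the
output list of the side they pad (`length_powN`, `fst_encodeBDDsRaw_le_length`).

References: Z. Dvir, D. Gutfreund, G. N. Rothblum, S. Vadhan, *On approximating the entropy of
polynomial mappings*, ECCC TR10-160 (2010) / ICS 2011, §3 p. 6 (products, gap conventions),
Thm 4.6, Claim 4.4; B. Applebaum, Y. Ishai, E. Kushilevitz, SIAM J. Comput. 36 (2006),
Lemma 4.15; S. Arora, B. Barak, *Computational Complexity*, CUP 2009, §1.3.
-/

namespace Summit.PneNP.PneNP.Cruxes.PeaThreeNotInP.SocketBP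

set_option linter.dupNamespace false -- `Summit.PneNP.PneNP.…`: summit = sub-problem name (D-0017)

open Literature.Computability.Complexity Literature.Computability.Complexity.RandPoly
open Literature.Computability.Cryptography (freshBDDs encodeBDDsMap)
open CodeFP (natE pairE rawE listE)
open Summit.PneNP.PneNP.Cruxes.PeaThreeNotInP.TensorIsoLine (powMap powN shiftN)

/-! ### The weak-gap problem and the instance maps -/

/-- **Entropy Difference for branching-program samplers with a constant gap `num/den`**,
`PEDBPGap num den`: on pairs `(p, q)` of samplers, YES iff `H(q(U)) ≤ H(p(U))`, NO iff
`H(p(U)) + num/den ≤ H(q(U))` (DGRV's `ED`-type problem with additive gap `num/den` split as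
`[0, num/den]`; all constant gaps are equivalent by direct products).
[cite: DvirGutfreundRothblumVadhan2010, §3 p.6] -/
noncomputable def PEDBPGap (num den : ℕ) : PromiseProblem :=
  PromiseProblem.ofEncoding PEDBPInst.encoding
    {I | bpEntropy I.2.1 I.2.2 ≤ bpEntropy I.1.1 I.1.2}
    {I | bpEntropy I.1.1 I.1.2 + (num : ℝ) / (den : ℝ) ≤ bpEntropy I.2.1 I.2.2}

/-- **The instance map `PEDBPGap → PED 3` with `T` copies**: `((n, Bs), (n', Bs')) ↦
((P̂^{×T}) × id_{T m' + 1}, (Q̂^{×T}) × id_{T m})` with `P̂`, `Q̂` the degree-3 perfect randomized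
encodings of the two samplers (`m`, `m'` random bits), so that
`H(p') − H(q') = T · (H(p) − H(q)) + 1`. [cite: DvirGutfreundRothblumVadhan2010, §3 p.6] -/
def toPEDGap (T : ℕ) (I : PEDBPInst) : PEDInst :=
  (⟨(I.1.1 + freshBDDs (compileAll I.1.1 I.1.2)) * T + (T * freshBDDs (compileAll I.2.1 I.2.2) + 1),
    (powMap (encodeBDDsMap I.1.1 (compileAll I.1.1 I.1.2)) T).prod
      (PolyMapF2.idMap (T * freshBDDs (compileAll I.2.1 I.2.2) + 1))⟩,
   ⟨(I.2.1 + freshBDDs (compileAll I.2.1 I.2.2)) * T + T * freshBDDs (compileAll I.1.1 I.1.2),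
    (powMap (encodeBDDsMap I.2.1 (compileAll I.2.1 I.2.2)) T).prod
      (PolyMapF2.idMap (T * freshBDDs (compileAll I.1.1 I.1.2)))⟩)

/-- **The raw instance map `PEDBPGap → PED 3` with `T` copies** (nested lists of naturals, the
format of the `CodeFP` kit): `T` shifted copies `powN` of each side's raw encoding
`(N, P) = encodeBDDsRaw n n Bs`, padded (`prodRaw`) with the raw identity map on `T · m' + 1`,
resp. `T · m`, fresh variables (`m = N − n`). [cite: DvirGutfreundRothblumVadhan2010, §3 p.6] -/
def toPEDGapRaw (T : ℕ) (c : (ℕ × List (List (ℕ × ℕ × ℕ × ℕ))) × (ℕ × List (List (ℕ × ℕ × ℕ × ℕ)))) : (ℕ × List (List (List ℕ))) × (ℕ × List (List (List ℕ))) :=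
  (((encodeBDDsRaw c.1.1 c.1.1 c.1.2).1 * T + (T * ((encodeBDDsRaw c.2.1 c.2.1 c.2.2).1 - c.2.1) + 1),
    prodRaw ((encodeBDDsRaw c.1.1 c.1.1 c.1.2).1 * T)
      (powN (encodeBDDsRaw c.1.1 c.1.1 c.1.2).1 (encodeBDDsRaw c.1.1 c.1.1 c.1.2).2 (List.range T))
      (idMapRaw (T * ((encodeBDDsRaw c.2.1 c.2.1 c.2.2).1 - c.2.1) + 1))),
   ((encodeBDDsRaw c.2.1 c.2.1 c.2.2).1 * T + T * ((encodeBDDsRaw c.1.1 c.1.1 c.1.2).1 - c.1.1),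
    prodRaw ((encodeBDDsRaw c.2.1 c.2.1 c.2.2).1 * T)
      (powN (encodeBDDsRaw c.2.1 c.2.1 c.2.2).1 (encodeBDDsRaw c.2.1 c.2.1 c.2.2).2 (List.range T))
      (idMapRaw (T * ((encodeBDDsRaw c.1.1 c.1.1 c.1.2).1 - c.1.1)))))

/-! ### Unfolding the weak-gap problem -/

/-- Unfolding the yes-instances of `PEDBPGap`: `H(q) ≤ H(p)`.
[cite: DvirGutfreundRothblumVadhan2010, Def 3.1] -/
theorem encode_mem_PEDBPGap_yes_iff (num den : ℕ) (I : PEDBPInst) :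
    PEDBPInst.encoding.encode I ∈ (PEDBPGap num den).yes ↔
      bpEntropy I.2.1 I.2.2 ≤ bpEntropy I.1.1 I.1.2 :=
  PEDBPInst.encoding.mem_toLanguage_iff _ I

/-- Unfolding the no-instances of `PEDBPGap`: `H(p) + num/den ≤ H(q)`.
[cite: DvirGutfreundRothblumVadhan2010, Def 3.1] -/
theorem encode_mem_PEDBPGap_no_iff (num den : ℕ) (I : PEDBPInst) :
    PEDBPInst.encoding.encode I ∈ (PEDBPGap num den).no ↔
      bpEntropy I.1.1 I.1.2 + (num : ℝ) / (den : ℝ) ≤ bpEntropy I.2.1 I.2.2 :=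
  PEDBPInst.encoding.mem_toLanguage_iff _ I

/-! ### Semantics: entropy bookkeeping and degrees (`stub_toPEDGap_mem`) -/

/-- The first map of the image has entropy `T · (H(p) + m) + (T · m' + 1)`.
[cite: DvirGutfreundRothblumVadhan2010, §3 p.6] -/
theorem entropy_toPEDGap_fst (T : ℕ) (I : PEDBPInst) :
    (toPEDGap T I).1.2.entropy =
      T * (bpEntropy I.1.1 I.1.2 + freshBDDs (compileAll I.1.1 I.1.2)) +
        ((T * freshBDDs (compileAll I.2.1 I.2.2) + 1 : ℕ) : ℝ) := by
  show ((powMap (encodeBDDsMap I.1.1 (compileAll I.1.1 I.1.2)) T).prod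
    (PolyMapF2.idMap (T * freshBDDs (compileAll I.2.1 I.2.2) + 1))).entropy = _
  rw [PolyMapF2.entropy_prod, PolyMapF2.entropy_idMap,
    Summit.PneNP.PneNP.Cruxes.PeaThreeNotInP.TensorIsoLine.entropy_powMap]
  have h : (encodeBDDsMap I.1.1 (compileAll I.1.1 I.1.2)).entropy =
      bpEntropy I.1.1 I.1.2 + freshBDDs (compileAll I.1.1 I.1.2) :=
    Literature.Computability.Cryptography.entropy_encodeBDDsMap _ _
  rw [h]

/-- The second map of the image has entropy `T · (H(q) + m') + T · m`.
[cite: DvirGutfreundRothblumVadhan2010, §3 p.6] -/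
theorem entropy_toPEDGap_snd (T : ℕ) (I : PEDBPInst) :
    (toPEDGap T I).2.2.entropy =
      T * (bpEntropy I.2.1 I.2.2 + freshBDDs (compileAll I.2.1 I.2.2)) +
        ((T * freshBDDs (compileAll I.1.1 I.1.2) : ℕ) : ℝ) := by
  show ((powMap (encodeBDDsMap I.2.1 (compileAll I.2.1 I.2.2)) T).prod
    (PolyMapF2.idMap (T * freshBDDs (compileAll I.1.1 I.1.2)))).entropy = _
  rw [PolyMapF2.entropy_prod, PolyMapF2.entropy_idMap,
    Summit.PneNP.PneNP.Cruxes.PeaThreeNotInP.TensorIsoLine.entropy_powMap]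
  have h : (encodeBDDsMap I.2.1 (compileAll I.2.1 I.2.2)).entropy =
      bpEntropy I.2.1 I.2.2 + freshBDDs (compileAll I.2.1 I.2.2) :=
    Literature.Computability.Cryptography.entropy_encodeBDDsMap _ _
  rw [h]

/-- The first map of the image has degree `≤ 3`.
[cite: DvirGutfreundRothblumVadhan2010, Thm 4.5] -/
theorem degLE_toPEDGap_fst (T : ℕ) (I : PEDBPInst) : (toPEDGap T I).1.2.DegLE 3 :=
  (Summit.PneNP.PneNP.Cruxes.PeaThreeNotInP.TensorIsoLine.degLE_powMap
    (Literature.Computability.Cryptography.degLE_three_encodeBDDsMap _ _) T).prod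
    (PolyMapF2.degLE_idMap (by norm_num) _)

/-- The second map of the image has degree `≤ 3`.
[cite: DvirGutfreundRothblumVadhan2010, Thm 4.5] -/
theorem degLE_toPEDGap_snd (T : ℕ) (I : PEDBPInst) : (toPEDGap T I).2.2.DegLE 3 :=
  (Summit.PneNP.PneNP.Cruxes.PeaThreeNotInP.TensorIsoLine.degLE_powMap
    (Literature.Computability.Cryptography.degLE_three_encodeBDDsMap _ _) T).prod
    (PolyMapF2.degLE_idMap (by norm_num) _)

/-- **`toPEDGap (2 den)` maps YES of `PEDBPGap num den` to YES of `PED 3` and NO to NO**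
(`0 < num`, `0 < den`): `H(p') − H(q') = 2 den · (H(p) − H(q)) + 1`, which is `≥ 1` when
`H(q) ≤ H(p)` and `≤ 1 − 2 num ≤ −1` when `H(p) + num/den ≤ H(q)`; degrees `≤ 3`.
[cite: DvirGutfreundRothblumVadhan2010, §3 p.6] -/
theorem stub_toPEDGap_mem (num den : ℕ) (hnum : 0 < num) (hden : 0 < den) : (∀ I : PEDBPInst, PEDBPInst.encoding.encode I ∈ (PEDBPGap num den).yes → PEDInst.encoding.encode (toPEDGap (2 * den) I) ∈ (PED 3).yes) ∧ (∀ I : PEDBPInst, PEDBPInst.encoding.encode I ∈ (PEDBPGap num den).no → PEDInst.encoding.encode (toPEDGap (2 * den) I) ∈ (PED 3).no) := by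
  have hden' : (0 : ℝ) < den := by exact_mod_cast hden
  have hnum' : (1 : ℝ) ≤ num := by exact_mod_cast hnum
  refine ⟨fun I hI => ?_, fun I hI => ?_⟩
  · rw [encode_mem_PEDBPGap_yes_iff] at hI
    rw [encode_mem_PED_yes_iff]
    refine ⟨degLE_toPEDGap_fst _ I, degLE_toPEDGap_snd _ I, ?_⟩
    rw [entropy_toPEDGap_fst, entropy_toPEDGap_snd]
    have hmul : (2 * den : ℝ) * bpEntropy I.2.1 I.2.2 ≤ (2 * den : ℝ) * bpEntropy I.1.1 I.1.2 :=
      mul_le_mul_of_nonneg_left hI (by positivity)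
    push_cast
    linarith
  · rw [encode_mem_PEDBPGap_no_iff] at hI
    rw [encode_mem_PED_no_iff]
    refine ⟨degLE_toPEDGap_fst _ I, degLE_toPEDGap_snd _ I, ?_⟩
    rw [entropy_toPEDGap_fst, entropy_toPEDGap_snd]
    have hmul : (2 * den : ℝ) * (bpEntropy I.1.1 I.1.2 + (num : ℝ) / (den : ℝ)) ≤
        (2 * den : ℝ) * bpEntropy I.2.1 I.2.2 :=
      mul_le_mul_of_nonneg_left hI (by positivity)
    have hcancel : (2 * den : ℝ) * ((num : ℝ) / (den : ℝ)) = 2 * num := by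
      field_simp
    rw [mul_add, hcancel] at hmul
    push_cast
    linarith

/-! ### The budget of the identity maps: the `T` copies are long enough -/

/-- Re-indexing preserves the number of outputs. [folklore] -/
theorem length_shiftN (s : ℕ) (P : List (List (List ℕ))) : (shiftN s P).length = P.length := by
  simp [shiftN]

/-- `|powN n P ts| = |ts| · |P|`. [folklore] -/
theorem length_powN (n : ℕ) (P : List (List (List ℕ))) :
    ∀ ts : List ℕ, (powN n P ts).length = ts.length * P.length
  | [] => by simp [powN]
  | t :: ts => by
    have ih := length_powN n P ts
    simp only [powN, List.map_cons, List.flatten_cons, List.length_append, length_shiftN,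
      List.length_cons] at ih ⊢
    rw [ih]
    ring

/-- The budget of the identity map padding the second side: `T · m ≤ |powN N P [0, T)|`
(`m = N − n₀ ≤ |P|`). [folklore] -/
theorem mul_sub_le_length_powN (T n n₀ : ℕ) (Bs : List (List (ℕ × ℕ × ℕ × ℕ))) :
    T * ((encodeBDDsRaw n n₀ Bs).1 - n₀) ≤
      (powN (encodeBDDsRaw n n₀ Bs).1 (encodeBDDsRaw n n₀ Bs).2 (List.range T)).length := by
  rw [length_powN, List.length_range]
  exact Nat.mul_le_mul_left T (sub_le_length_encodeBDDsRaw n n₀ Bs)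

/-! ### The typed polynomial-time clause (`stub_toPEDGapRawFP`) -/

/-- **The raw instance map `toPEDGapRaw T` is typed polynomial time** between the codes of
`PEDBPGap` and `PED 3` instances, given a typed polynomial-time program for the raw list
encoding `(n, n₀, Bs) ↦ encodeBDDsRaw n n₀ Bs`. [cite: DvirGutfreundRothblumVadhan2010, §3 p.6] -/
theorem stub_toPEDGapRawFP (T : ℕ) (hA : CodeFP (pairE natE (pairE natE (rawE (rawE (pairE natE (pairE natE (pairE natE natE))))))) (pairE natE (rawE (rawE (rawE natE)))) (fun c => encodeBDDsRaw c.1 c.2.1 c.2.2)) : CodeFP (pairE (pairE natE (listE (listE (pairE natE (pairE natE (pairE natE natE)))))) (pairE natE (listE (listE (pairE natE (pairE natE (pairE natE natE))))))) (pairE (pairE natE (listE (listE (listE natE)))) (pairE natE (listE (listE (listE natE))))) (toPEDGapRaw T) := by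
  let nodeE : ℕ × ℕ × ℕ × ℕ → List Bool := pairE natE (pairE natE (pairE natE natE))
  let sideE : ℕ × List (List (ℕ × ℕ × ℕ × ℕ)) → List Bool := pairE natE (listE (listE nodeE))
  let inE : (ℕ × List (List (ℕ × ℕ × ℕ × ℕ))) × (ℕ × List (List (ℕ × ℕ × ℕ × ℕ))) → List Bool :=
    pairE sideE sideE
  let P3 : List (List (List ℕ)) → List Bool := rawE (rawE (rawE natE))
  -- (every map whose value mentions `encodeBDDsRaw` is re-targeted by `congr … rfl`: unifying
  -- such targets during elaboration makes the unifier unfold the recursion and time out)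
  -- headed → raw programs, raw → headed outputs
  have hraw : CodeFP (listE (listE nodeE)) (rawE (rawE nodeE)) id :=
    ((CodeFP.map₀ (CodeFP.rawOfList nodeE)).comp (CodeFP.rawOfList (listE nodeE))).congr fun Bs => by
      simp
  have hhead : CodeFP P3 (listE (listE (listE natE))) id :=
    ((CodeFP.listOfRaw (listE (listE natE))).comp (CodeFP.map₀ ((CodeFP.listOfRaw (listE natE)).comp
      (CodeFP.map₀ (CodeFP.listOfRaw natE))))).congr fun P => by simp
  -- the encoding of one side `(n, Bs) ↦ encodeBDDsRaw n n Bs`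
  have hargs : CodeFP sideE (pairE natE (pairE natE (rawE (rawE nodeE)))) (fun q => (q.1, q.1, q.2)) :=
    ((CodeFP.fst _ _).pair ((CodeFP.fst _ _).pair (hraw.comp (CodeFP.snd _ _)))).congr fun _ => rfl
  have hside : CodeFP sideE (pairE natE P3) (fun q => encodeBDDsRaw q.1 q.1 q.2) :=
    (hA.comp hargs).congr fun _ => rfl
  have h1 : CodeFP inE (pairE natE P3) (fun c => encodeBDDsRaw c.1.1 c.1.1 c.1.2) :=
    (hside.comp (CodeFP.fst _ _)).congr fun _ => rfl
  have h2 : CodeFP inE (pairE natE P3) (fun c => encodeBDDsRaw c.2.1 c.2.1 c.2.2) :=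
    (hside.comp (CodeFP.snd _ _)).congr fun _ => rfl
  -- counters, outputs, numbers of random bits of the two sides
  have hN1 : CodeFP inE natE (fun c => (encodeBDDsRaw c.1.1 c.1.1 c.1.2).1) := h1.fst'.congr fun _ => rfl
  have hN2 : CodeFP inE natE (fun c => (encodeBDDsRaw c.2.1 c.2.1 c.2.2).1) := h2.fst'.congr fun _ => rfl
  have hP1 : CodeFP inE P3 (fun c => (encodeBDDsRaw c.1.1 c.1.1 c.1.2).2) := h1.snd'.congr fun _ => rfl
  have hP2 : CodeFP inE P3 (fun c => (encodeBDDsRaw c.2.1 c.2.1 c.2.2).2) := h2.snd'.congr fun _ => rfl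
  have hm1 : CodeFP inE natE (fun c => (encodeBDDsRaw c.1.1 c.1.1 c.1.2).1 - c.1.1) :=
    (CodeFP.natSub.comp (hN1.pair (CodeFP.fst _ _).fst')).congr fun _ => rfl
  have hm2 : CodeFP inE natE (fun c => (encodeBDDsRaw c.2.1 c.2.1 c.2.2).1 - c.2.1) :=
    (CodeFP.natSub.comp (hN2.pair (CodeFP.snd _ _).fst')).congr fun _ => rfl
  -- the scaled counters `N · T`, `T · m`, `T · m' + 1`
  have hT : CodeFP inE natE (fun _ => T) := CodeFP.const _ T
  have hNT1 : CodeFP inE natE (fun c => (encodeBDDsRaw c.1.1 c.1.1 c.1.2).1 * T) :=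
    (CodeFP.natMul.comp (hN1.pair hT)).congr fun _ => rfl
  have hNT2 : CodeFP inE natE (fun c => (encodeBDDsRaw c.2.1 c.2.1 c.2.2).1 * T) :=
    (CodeFP.natMul.comp (hN2.pair hT)).congr fun _ => rfl
  have hTm1 : CodeFP inE natE (fun c => T * ((encodeBDDsRaw c.1.1 c.1.1 c.1.2).1 - c.1.1)) :=
    (CodeFP.natMul.comp (hT.pair hm1)).congr fun _ => rfl
  have hTm2 : CodeFP inE natE (fun c => T * ((encodeBDDsRaw c.2.1 c.2.1 c.2.2).1 - c.2.1) + 1) :=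
    (CodeFP.natAdd.comp ((CodeFP.natMul.comp (hT.pair hm2)).pair (CodeFP.const _ 1))).congr
      fun _ => rfl
  -- the `T` copies of each side
  have hpow1 : CodeFP inE P3 (fun c => powN (encodeBDDsRaw c.1.1 c.1.1 c.1.2).1
      (encodeBDDsRaw c.1.1 c.1.1 c.1.2).2 (List.range T)) :=
    (Summit.PneNP.PneNP.Cruxes.PeaThreeNotInP.TensorIsoLine.codeFP_powN.comp
      ((hN1.pair hP1).pair (CodeFP.const _ (List.range T)))).congr fun _ => rfl
  have hpow2 : CodeFP inE P3 (fun c => powN (encodeBDDsRaw c.2.1 c.2.1 c.2.2).1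
      (encodeBDDsRaw c.2.1 c.2.1 c.2.2).2 (List.range T)) :=
    (Summit.PneNP.PneNP.Cruxes.PeaThreeNotInP.TensorIsoLine.codeFP_powN.comp
      ((hN2.pair hP2).pair (CodeFP.const _ (List.range T)))).congr fun _ => rfl
  -- the identity maps, each with the copies of its own side as unary budget
  have hid1 : CodeFP inE P3 (fun c => idMapRaw (T * ((encodeBDDsRaw c.1.1 c.1.1 c.1.2).1 - c.1.1))) :=
    (codeFP_idMapRaw.comp (hpow1.pair hTm1)).congr fun c => by
      show idMapRaw (min (T * ((encodeBDDsRaw c.1.1 c.1.1 c.1.2).1 - c.1.1))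
        (powN (encodeBDDsRaw c.1.1 c.1.1 c.1.2).1 (encodeBDDsRaw c.1.1 c.1.1 c.1.2).2
          (List.range T)).length) = _
      rw [min_eq_left (mul_sub_le_length_powN _ _ _ _)]
  have hid2 : CodeFP inE P3
      (fun c => idMapRaw (T * ((encodeBDDsRaw c.2.1 c.2.1 c.2.2).1 - c.2.1) + 1)) :=
    (codeFP_idMapRaw.comp (((CodeFP.rawCons (rawE (rawE natE))).comp
      ((CodeFP.const _ ([] : List (List ℕ))).pair hpow2)).pair hTm2)).congr fun c => by
      show idMapRaw (min (T * ((encodeBDDsRaw c.2.1 c.2.1 c.2.2).1 - c.2.1) + 1)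
        (([] : List (List ℕ)) :: powN (encodeBDDsRaw c.2.1 c.2.1 c.2.2).1
          (encodeBDDsRaw c.2.1 c.2.1 c.2.2).2 (List.range T)).length) = _
      rw [List.length_cons, min_eq_left (Nat.succ_le_succ (mul_sub_le_length_powN _ _ _ _))]
  -- the two output sides
  have hout1 : CodeFP inE (pairE natE (listE (listE (listE natE))))
      (fun c => ((encodeBDDsRaw c.1.1 c.1.1 c.1.2).1 * T +
          (T * ((encodeBDDsRaw c.2.1 c.2.1 c.2.2).1 - c.2.1) + 1),
        prodRaw ((encodeBDDsRaw c.1.1 c.1.1 c.1.2).1 * T)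
          (powN (encodeBDDsRaw c.1.1 c.1.1 c.1.2).1 (encodeBDDsRaw c.1.1 c.1.1 c.1.2).2
            (List.range T))
          (idMapRaw (T * ((encodeBDDsRaw c.2.1 c.2.1 c.2.2).1 - c.2.1) + 1)))) :=
    ((CodeFP.natAdd.comp (hNT1.pair hTm2)).pair
      (hhead.comp (codeFP_prodRaw.comp (hNT1.pair (hpow1.pair hid2))))).congr fun _ => rfl
  have hout2 : CodeFP inE (pairE natE (listE (listE (listE natE))))
      (fun c => ((encodeBDDsRaw c.2.1 c.2.1 c.2.2).1 * T +
          T * ((encodeBDDsRaw c.1.1 c.1.1 c.1.2).1 - c.1.1),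
        prodRaw ((encodeBDDsRaw c.2.1 c.2.1 c.2.2).1 * T)
          (powN (encodeBDDsRaw c.2.1 c.2.1 c.2.2).1 (encodeBDDsRaw c.2.1 c.2.1 c.2.2).2
            (List.range T))
          (idMapRaw (T * ((encodeBDDsRaw c.1.1 c.1.1 c.1.2).1 - c.1.1))))) :=
    ((CodeFP.natAdd.comp (hNT2.pair hTm1)).pair
      (hhead.comp (codeFP_prodRaw.comp (hNT2.pair (hpow2.pair hid1))))).congr fun _ => rfl
  exact (hout1.pair hout2).congr fun _ => rfl

end Summit.PneNP.PneNP.Cruxes.PeaThreeNotInP.SocketBP
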